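import Summits.AnomalousDissipation.AnomalousDissipation.Theorems.MarginalStabilityChainStrainedLayerLawClockCentroidLawTools
import HarnessLib

/-!
# Crux `MarginalStabilityChain.StrainedLayerLaw` (stmt-AnomalousDissipation-3007), line `FirstLemmasR2K4`
# (log-enstrophy clock + Nash roundness): the vorticity centroid law

Support file (`--supports stmt-AnomalousDissipation-3007`; registered sub-goal `vorticity_centroid_law` of line
`FirstLemmasR2K4`, lead c7, wave 1).

What it proves: along every classical solution `(u, v, p)` of the stretched two-dimensional Navier–Stokes layer
class on `(0, ∞)` (`ν, L > 0`, normalisation `γ = ΔU = 1`) with shear tails on every compact time interval, the first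
`y`-moment of the vorticity over one period strip, `M₁(t) = ∫_{x ∈ (0,L]} ∫_y y ω(t, x, y)` (`ω = ∂ₓv − ∂_yu`), obeys
the EXACT law `M₁(t) = e^{−(t−s)} M₁(s)` (`0 < s ≤ t`): the vorticity centroid relaxes to the stagnation line at the
strain rate, uniformly in `ν` (formally `M₁′ = ∫∫ y(−U·∇ω + ω + νΔω) = ∫∫ ωv − M₁ = −M₁`, `U = (u, v − y)`).

Route (rigorous, cutoff in `y`; tools in `…ClockCentroidLawTools.lean`): with the weight
`ψ_R(y) = y σ(2 − y/R) σ(2 + y/R)` (`σ` = `Real.smoothTransition`) the renormalised vorticity balance at one instant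
(tools B/D of `stub_negEnstrophyLaw`, `F(r) = r`) and differentiation under the integral sign (tools C) give
`N_R′ = B_R − νE_R` on `t > 0`, `N_R = ∫∫ ωψ_R`, `B_R = ∫∫ ω(v − y)ψ_R′`, `E_R = ∫∫ ∂_yω ψ_R′`
(`centroidLaw_hasDerivAt`); the fundamental theorem of calculus for `eᵗN_R` on `[s, t]`; then `R → ∞` by dominated
convergence on the strip at each instant (`centroidLaw_sliceLimits`: `N_R → M₁`, `B_R → ∫∫ ω(v − y) = −M₁` since
`∫∫ ωv = 0`, `E_R → ∫∫ ∂_yω = 0`) and in time (majorants uniform on `[s, t]`), whence `eᵗM₁(t) = eˢM₁(s)`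
(`centroidLaw_exp_identity`). Finally the strip integrals are the line's iterated integrals (Fubini). All `[folklore]`
(moment laws of 2-D vorticity dynamics in a strain: e.g. Majda–Bertozzi, *Vorticity and Incompressible Flow*,
CUP 2002, §1.4).
-/

-- `Summit.<Summit>.<Problem>` is the tree's mandated summit-side namespace (CONVENTIONS §2); for this
-- single-conjunct summit the two coincide, so the duplicate is deliberate.
set_option linter.dupNamespace false

noncomputable section

open scoped Topology ENNReal
open Filter Set Function MeasureTheory

namespace Summit.AnomalousDissipation.AnomalousDissipation.Theorems.StrainedLayerLaw.LogEnstrophyClock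

open Literature.Analysis.FluidPDE Literature.Analysis.FluidPDE.StretchedLayer
open Summit.AnomalousDissipation.AnomalousDissipation.Theses.MarginalStabilityChain
open Summit.AnomalousDissipation.AnomalousDissipation.Theorems.StrainedLayerLaw.StrainWorkSumRule

/-! ## Along the solution: the derivative of `N`, and `eᵗM₁(t) = eˢM₁(s)` -/

section Solution

variable {ν L : ℝ} {u v p : ℝ → ℝ → ℝ → ℝ}

/-- **`d/dτ ∫∫ ω(τ)ψ = ∫∫ ω(v − y)ψ′ − ν∫∫ ∂_yω ψ′`** on `τ > 0`, for a `C¹` bounded weight `ψ` vanishing for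
`|y| ≥ R′`: differentiation under the integral sign (tools C, applied to `ψ/A`) and the renormalised balance at one
instant with `F(r) = r` (tools B/D: the `(ωF′ − F)` and `F″` terms vanish). [folklore] -/
theorem centroidLaw_hasDerivAt (hsol : IsStretchedLayerNSSolutionOn (Ioi 0) ν 1 1 L u v p) (hL : 0 < L)
    {ψ : ℝ → ℝ} (hψ : ContDiff ℝ 1 ψ) {A R' : ℝ} (hA : 0 < A) (hψA : ∀ y, |ψ y| ≤ A)
    (hψR : ∀ y, R' ≤ |y| → ψ y = 0) {τ : ℝ} (hτ : 0 < τ) :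
    HasDerivAt (fun s => ∫ q in Ioc 0 L ×ˢ univ, vorticity (u s) (v s) q.1 q.2 * ψ q.2)
      ((∫ q in Ioc 0 L ×ˢ univ, vorticity (u τ) (v τ) q.1 q.2 * (v τ q.1 q.2 - q.2) * deriv ψ q.2) -
        ν * ∫ q in Ioc 0 L ×ˢ univ, 1 * dY (vorticity (u τ) (v τ)) q.1 q.2 * deriv ψ q.2) τ := by
  have hA0 : A ≠ 0 := hA.ne'
  have hτI : τ ∈ Ioo (τ / 2) (τ + 1) := ⟨by linarith, by linarith⟩
  have hψc : Continuous fun y => ψ y / A := hψ.continuous.div_const A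
  have hψ1 : ∀ y, |ψ y / A| ≤ 1 := fun y => by
    rw [abs_div, abs_of_pos hA, div_le_one hA]; exact hψA y
  have hψ0 : ∀ y, R' ≤ |y| → ψ y / A = 0 := fun y hy => by rw [hψR y hy, zero_div]
  have h1 := stub_negEnstrophyLaw_timeDerivative u v (fun r => r) (fun _ => 1) (fun y => ψ y / A) L R' (τ / 2)
    (τ + 1) τ hsol.contDiffOn_u hsol.contDiffOn_v (fun r => hasDerivAt_id' r) continuous_const hψc hψ1 hψ0
    (half_pos hτ) hτI
  have h2 := clock_slice_identity hsol hL hτ (F := fun r => r) (F' := fun _ => (1:ℝ)) (F'' := fun _ => (0:ℝ))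
    (fun r => hasDerivAt_id' r) (fun r => hasDerivAt_const r (1:ℝ)) contDiff_const continuous_const hψ hψR
  have eN : ∀ s, (∫ q in Ioc 0 L ×ˢ univ, vorticity (u s) (v s) q.1 q.2 * ψ q.2) =
      A * ∫ q in Ioc 0 L ×ˢ univ, vorticity (u s) (v s) q.1 q.2 * (ψ q.2 / A) := fun s => by
    rw [← integral_const_mul]
    refine integral_congr_ae (Eventually.of_forall fun q => ?_)
    simp only
    field_simp
  have eD : A * (∫ q in Ioc 0 L ×ˢ univ, 1 * (ψ q.2 / A) *
      (dX (fun x y => deriv (fun s => v s x y) τ) q.1 q.2 - dY (fun x y => deriv (fun s => u s x y) τ) q.1 q.2)) =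
      ∫ q in Ioc 0 L ×ˢ univ, 1 * ψ q.2 *
        (dX (fun x y => deriv (fun s => v s x y) τ) q.1 q.2 - dY (fun x y => deriv (fun s => u s x y) τ) q.1 q.2) := by
    rw [← integral_const_mul]
    refine integral_congr_ae (Eventually.of_forall fun q => ?_)
    simp only
    field_simp
  have h3 : HasDerivAt (fun s => ∫ q in Ioc 0 L ×ˢ univ, vorticity (u s) (v s) q.1 q.2 * ψ q.2)
      (A * ∫ q in Ioc 0 L ×ˢ univ, 1 * (ψ q.2 / A) *
        (dX (fun x y => deriv (fun s => v s x y) τ) q.1 q.2 - dY (fun x y => deriv (fun s => u s x y) τ) q.1 q.2))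
      τ :=
    (h1.const_mul A).congr_of_eventuallyEq (Eventually.of_forall eN)
  refine h3.congr_deriv ?_
  rw [eD]
  refine h2.trans ?_
  simp only [mul_one, sub_self, zero_mul, integral_zero, zero_add, mul_zero, sub_zero]

/-- **`eᵗM₁(t) = eˢM₁(s)`** (strip form, `0 < s ≤ t`) along a classical solution with shear tails on compact time
intervals: the fundamental theorem of calculus for `eᵗN_R` on `[s, t]` (`N_R′ = B_R − νE_R`), then `R → ∞` by
dominated convergence on the strip at each instant and in time (`N_R → M₁`, `B_R → −M₁`, `E_R → 0`, all bounded
uniformly on `[s, t]`). [folklore] -/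
theorem centroidLaw_exp_identity (hν : 0 ≤ ν) (hL : 0 < L) (hsol : IsStretchedLayerNSSolutionOn (Ioi 0) ν 1 1 L u v p)
    (htails : ∀ a b : ℝ, 0 < a → a < b → ExpTails (Icc a b) u v) {s t : ℝ} (hs : 0 < s) (hst : s ≤ t) :
    Real.exp t * ∫ q in Ioc 0 L ×ˢ univ, q.2 * vorticity (u t) (v t) q.1 q.2 =
      Real.exp s * ∫ q in Ioc 0 L ×ˢ univ, q.2 * vorticity (u s) (v s) q.1 q.2 := by
  obtain ⟨C, k, hk, hCk⟩ := htails (s / 2) (t + 1) (by positivity) (by linarith)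
  have hST : ∀ τ ∈ Icc s t, SliceTails C k (u τ) (v τ) := fun τ hτ =>
    (hCk τ ⟨by linarith [hτ.1], by linarith [hτ.2]⟩).1
  have hC : 0 ≤ C := (hST s ⟨le_rfl, hst⟩).nonneg
  obtain ⟨Cσ, hCσ0, hCσ⟩ := kato_smoothTransition_deriv_bound
  have hpos : ∀ {τ : ℝ}, τ ∈ Icc s t → 0 < τ := fun hτ => hs.trans_le hτ.1
  have hu2 : ∀ {τ : ℝ}, 0 < τ → ContDiff ℝ 2 (fun q : ℝ × ℝ => u τ q.1 q.2) := fun hτ =>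
    hsol.contDiff_u (mem_Ioi.2 hτ)
  have hv2 : ∀ {τ : ℝ}, 0 < τ → ContDiff ℝ 2 (fun q : ℝ × ℝ => v τ q.1 q.2) := fun hτ =>
    hsol.contDiff_v (mem_Ioi.2 hτ)
  have hdiv : ∀ {τ : ℝ}, 0 < τ → ∀ x y, dX (u τ) x y + dY (v τ) x y = 0 := fun hτ => hsol.divFree _ (mem_Ioi.2 hτ)
  have huper : ∀ {τ : ℝ}, 0 < τ → ∀ x y, u τ (x + L) y = u τ x y := fun hτ => hsol.periodic_u _ (mem_Ioi.2 hτ)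
  have hvper : ∀ {τ : ℝ}, 0 < τ → ∀ x y, v τ (x + L) y = v τ x y := fun hτ => hsol.periodic_v _ (mem_Ioi.2 hτ)
  have hIsub : uIoc s t ⊆ Ioi 0 := fun τ hτ => by rw [uIoc_of_le hst] at hτ; exact hs.trans hτ.1
  have hsub : uIcc s t ⊆ Ioi 0 := fun τ hτ => by rw [uIcc_of_le hst] at hτ; exact hs.trans_le hτ.1
  -- the weights and the functionals
  set IW : ℝ := ∫ q in Ioc 0 L ×ˢ univ, (C + |q.2|) * Real.exp (-k * |q.2|) with hIW
  set Ik : ℝ := ∫ q in Ioc 0 L ×ˢ univ, Real.exp (-k * |q.2|) with hIk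
  set ψ : ℝ → ℝ → ℝ := fun R y => y * (Real.smoothTransition (2 - y / R) * Real.smoothTransition (2 + y / R))
    with hψ
  set N : ℝ → ℝ → ℝ := fun R τ => ∫ q in Ioc 0 L ×ˢ univ, vorticity (u τ) (v τ) q.1 q.2 * ψ R q.2 with hN
  set B : ℝ → ℝ → ℝ := fun R τ => ∫ q in Ioc 0 L ×ˢ univ, vorticity (u τ) (v τ) q.1 q.2 * (v τ q.1 q.2 - q.2) *
    deriv (ψ R) q.2 with hB
  set E : ℝ → ℝ → ℝ := fun R τ => ∫ q in Ioc 0 L ×ˢ univ, 1 * dY (vorticity (u τ) (v τ)) q.1 q.2 *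
    deriv (ψ R) q.2 with hE
  set M : ℝ → ℝ := fun τ => ∫ q in Ioc 0 L ×ˢ univ, q.2 * vorticity (u τ) (v τ) q.1 q.2 with hM
  -- (1) the derivative of `N R` (`R > 0`) and continuity of the functionals on `(0, ∞)`
  have hder : ∀ R, 0 < R → ∀ τ, 0 < τ → HasDerivAt (N R) (B R τ - ν * E R τ) τ := fun R hR τ hτ =>
    centroidLaw_hasDerivAt hsol hL (centroidLaw_weight_contDiff R) (mul_pos two_pos hR)
      (centroidLaw_weight_abs_le_two_mul hR) (fun y hy => centroidLaw_weight_eq_zero hR hy) hτ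
  have hψ'c : ∀ R, Continuous (deriv (ψ R)) := fun R => (centroidLaw_weight_contDiff R).continuous_deriv le_rfl
  have hψ'0 : ∀ R, 0 < R → ∀ y, 2 * R + 1 ≤ |y| → deriv (ψ R) y = 0 := fun R hR y hy =>
    centroidLaw_weight_deriv_eq_zero hR (by linarith)
  have hBc : ∀ R, 0 < R → ContinuousOn (B R) (Ioi 0) := fun R hR =>
    clock_continuousOn_B hsol.contDiffOn_u hsol.contDiffOn_v (F := fun r => r) continuous_id (hψ'c R)
      (hψ'0 R hR) L
  have hEc : ∀ R, 0 < R → ContinuousOn (E R) (Ioi 0) := fun R hR =>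
    clock_continuousOn_E hsol.contDiffOn_u hsol.contDiffOn_v (F' := fun _ => (1:ℝ)) continuous_const (hψ'c R)
      (hψ'0 R hR) L
  have hNc : ∀ R, 0 < R → ContinuousOn (N R) (Ioi 0) := fun R hR τ hτ =>
    (hder R hR τ hτ).continuousAt.continuousWithinAt
  have hGc : ∀ R, 0 < R → ContinuousOn (fun τ => Real.exp τ * N R τ + Real.exp τ * (B R τ - ν * E R τ)) (Ioi 0) :=
    fun R hR => (Real.continuous_exp.continuousOn.mul (hNc R hR)).add
      (Real.continuous_exp.continuousOn.mul ((hBc R hR).sub (continuousOn_const.mul (hEc R hR))))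
  -- (2) the fundamental theorem of calculus for `eᵗ N R` on `[s, t]`
  have hFTC : ∀ R, 0 < R → Real.exp t * N R t - Real.exp s * N R s =
      ∫ τ in s..t, (Real.exp τ * N R τ + Real.exp τ * (B R τ - ν * E R τ)) := by
    intro R hR
    have hd : ∀ τ ∈ uIcc s t, HasDerivAt (fun τ => Real.exp τ * N R τ)
        (Real.exp τ * N R τ + Real.exp τ * (B R τ - ν * E R τ)) τ := fun τ hτ =>
      (Real.hasDerivAt_exp τ).mul (hder R hR τ (hsub hτ))
    rw [intervalIntegral.integral_eq_sub_of_hasDerivAt hd ((hGc R hR).mono hsub).intervalIntegrable]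
  -- (3) the limits `R → ∞` at each instant of `[s, t]`
  have hNlim : ∀ {τ : ℝ}, τ ∈ Icc s t → Tendsto (fun R => N R τ) atTop (𝓝 (M τ)) := fun hτ =>
    centroidLaw_limit_N hk (hST _ hτ) (hu2 (hpos hτ)) (hv2 (hpos hτ))
  have hBlim : ∀ {τ : ℝ}, τ ∈ Icc s t → Tendsto (fun R => B R τ) atTop (𝓝 (-M τ)) := fun hτ =>
    centroidLaw_limit_B hL hk (hST _ hτ) (hu2 (hpos hτ)) (hv2 (hpos hτ)) (hdiv (hpos hτ)) (huper (hpos hτ))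
      (hvper (hpos hτ)) hCσ0 hCσ
  have hElim : ∀ {τ : ℝ}, τ ∈ Icc s t → Tendsto (fun R => E R τ) atTop (𝓝 0) := fun hτ =>
    centroidLaw_limit_E hk (hST _ hτ) (hu2 (hpos hτ)) (hv2 (hpos hτ)) (hdiv (hpos hτ)) hCσ0 hCσ
  -- (4) uniform bounds on `[s, t]`
  have hNb : ∀ {R τ : ℝ}, τ ∈ Icc s t → |N R τ| ≤ C * IW := fun {R τ} hτ => by
    rw [← Real.norm_eq_abs, hIW, ← integral_const_mul]
    exact norm_integral_le_of_norm_le ((kato_integrableOn_weight' hk hC L).const_mul C)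
      (Eventually.of_forall fun q => by rw [Real.norm_eq_abs]; exact centroidLaw_N_bound (hST τ hτ) R q)
  have hBb : ∀ {R τ : ℝ}, 0 < R → τ ∈ Icc s t → |B R τ| ≤ (1 + 4 * Cσ) * (C * IW) := fun {R τ} hR hτ => by
    rw [← Real.norm_eq_abs, hIW, ← integral_const_mul, ← integral_const_mul]
    exact norm_integral_le_of_norm_le (((kato_integrableOn_weight' hk hC L).const_mul C).const_mul _)
      (Eventually.of_forall fun q => by
        rw [Real.norm_eq_abs]; exact centroidLaw_B_bound hk (hST τ hτ) hR hCσ0 hCσ q)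
  have hEb : ∀ {R τ : ℝ}, 0 < R → τ ∈ Icc s t → |E R τ| ≤ (1 + 4 * Cσ) * (C * Ik) := fun {R τ} hR hτ => by
    rw [← Real.norm_eq_abs, hIk, ← integral_const_mul, ← integral_const_mul]
    exact norm_integral_le_of_norm_le (((kato_integrableOn_weight hk L).const_mul C).const_mul _)
      (Eventually.of_forall fun q => by
        rw [Real.norm_eq_abs]
        exact centroidLaw_E_bound (hST τ hτ) (hu2 (hpos hτ)) (hv2 (hpos hτ)) (hdiv (hpos hτ)) hR hCσ0 hCσ q)
  -- (5) dominated convergence in time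
  set K : ℝ := Real.exp t * (C * IW) + Real.exp t * ((1 + 4 * Cσ) * (C * IW) + ν * ((1 + 4 * Cσ) * (C * Ik)))
    with hK
  have hInt : Tendsto (fun R => ∫ τ in s..t, (Real.exp τ * N R τ + Real.exp τ * (B R τ - ν * E R τ))) atTop
      (𝓝 (∫ _ in s..t, (0:ℝ))) := by
    refine intervalIntegral.tendsto_integral_filter_of_dominated_convergence (fun _ => K) ?_ ?_
      intervalIntegrable_const ?_
    · filter_upwards [eventually_gt_atTop 0] with R hR
      exact ((hGc R hR).mono hIsub).aestronglyMeasurable measurableSet_uIoc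
    · filter_upwards [eventually_gt_atTop 0] with R hR
      refine Eventually.of_forall fun τ hτ => ?_
      rw [uIoc_of_le hst] at hτ
      have hτI : τ ∈ Icc s t := ⟨hτ.1.le, hτ.2⟩
      have he : Real.exp τ ≤ Real.exp t := Real.exp_le_exp.2 hτ.2
      have he0 : 0 ≤ Real.exp τ := (Real.exp_pos τ).le
      have het : 0 ≤ Real.exp t := (Real.exp_pos t).le
      have h1 := hNb (R := R) hτI
      have h2 := hBb hR hτI
      have h3 := hEb hR hτI
      rw [Real.norm_eq_abs]
      calc |Real.exp τ * N R τ + Real.exp τ * (B R τ - ν * E R τ)|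
          ≤ Real.exp τ * |N R τ| + Real.exp τ * (|B R τ| + ν * |E R τ|) := by
            refine (abs_add_le _ _).trans (add_le_add ?_ ?_)
            · rw [abs_mul, abs_of_nonneg he0]
            · rw [abs_mul, abs_of_nonneg he0]
              refine mul_le_mul_of_nonneg_left ((abs_sub _ _).trans (add_le_add_right ?_ _)) he0
              rw [abs_mul, abs_of_nonneg hν]
        _ ≤ K := add_le_add (mul_le_mul he h1 (abs_nonneg _) het)
            (mul_le_mul he (add_le_add h2 (mul_le_mul_of_nonneg_left h3 hν)) (by positivity) het)
    · refine Eventually.of_forall fun τ hτ => ?_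
      rw [uIoc_of_le hst] at hτ
      have hτI : τ ∈ Icc s t := ⟨hτ.1.le, hτ.2⟩
      have h := ((hNlim hτI).const_mul (Real.exp τ)).add
        (((hBlim hτI).sub ((hElim hτI).const_mul ν)).const_mul (Real.exp τ))
      rw [show Real.exp τ * M τ + Real.exp τ * (-M τ - ν * 0) = 0 by ring] at h
      exact h
  rw [intervalIntegral.integral_zero] at hInt
  -- (6) conclusion
  have hLHS : Tendsto (fun R => Real.exp t * N R t - Real.exp s * N R s) atTop
      (𝓝 (Real.exp t * M t - Real.exp s * M s)) :=
    ((hNlim ⟨hst, le_rfl⟩).const_mul _).sub ((hNlim ⟨le_rfl, hst⟩).const_mul _)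
  have hRHS : Tendsto (fun R => Real.exp t * N R t - Real.exp s * N R s) atTop (𝓝 0) := by
    refine hInt.congr' ?_
    filter_upwards [eventually_gt_atTop 0] with R hR
    exact (hFTC R hR).symm
  exact sub_eq_zero.1 (tendsto_nhds_unique hLHS hRHS)

end Solution

/-! ## The registered sub-goal -/

/-- **THE VORTICITY CENTROID LAW (registered sub-goal `vorticity_centroid_law` of line `FirstLemmasR2K4`).** Along
every classical solution of the stretched layer class on `(0, ∞)` (`ν, L > 0`) with shear tails on compact time
intervals, the first `y`-moment of the vorticity over one period strip satisfies, for `0 < s ≤ t`,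
`∫_{x ∈ (0,L]} ∫_y y ω(t) = e^{−(t−s)} ∫_{x ∈ (0,L]} ∫_y y ω(s)`: `centroidLaw_exp_identity` (`eᵗM₁(t) = eˢM₁(s)` in
strip form) and Fubini (`|yω| ≤ C|y|e^{−k|y|}` is integrable on the strip). [folklore] -/
theorem vorticity_centroid_law : ∀ (ν L : ℝ), 0 < ν → 0 < L → ∀ (u v p : ℝ → ℝ → ℝ → ℝ),
    IsStretchedLayerNSSolutionOn (Ioi 0) ν 1 1 L u v p → (∀ a b : ℝ, 0 < a → a < b → ExpTails (Icc a b) u v) →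
    ∀ s t : ℝ, 0 < s → s ≤ t → (∫ x in Ioc 0 L, ∫ y, y * vorticity (u t) (v t) x y) =
      Real.exp (-(t - s)) * ∫ x in Ioc 0 L, ∫ y, y * vorticity (u s) (v s) x y := by
  intro ν L hν hL u v p hsol htails s t hs hst
  have h := centroidLaw_exp_identity hν.le hL hsol htails hs hst
  obtain ⟨C, k, hk, hCk⟩ := htails (s / 2) (t + 1) (by positivity) (by linarith)
  have eS : ∀ τ ∈ Icc s t, (∫ x in Ioc 0 L, ∫ y, y * vorticity (u τ) (v τ) x y) =
      ∫ q in Ioc 0 L ×ˢ univ, q.2 * vorticity (u τ) (v τ) q.1 q.2 := fun τ hτ => by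
    have hτ0 : τ ∈ Ioi (0:ℝ) := hs.trans_le hτ.1
    exact integral_iterated_eq_strip (F := fun q : ℝ × ℝ => q.2 * vorticity (u τ) (v τ) q.1 q.2)
      (centroidLaw_integrableOn_moment hk (hCk τ ⟨by linarith [hτ.1], by linarith [hτ.2]⟩).1
        (hsol.contDiff_u hτ0) (hsol.contDiff_v hτ0))
  rw [eS t ⟨hst, le_rfl⟩, eS s ⟨le_rfl, hst⟩]
  have het : Real.exp t ≠ 0 := (Real.exp_pos t).ne'
  calc ∫ q in Ioc 0 L ×ˢ univ, q.2 * vorticity (u t) (v t) q.1 q.2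
      = (Real.exp t)⁻¹ * (Real.exp t * ∫ q in Ioc 0 L ×ˢ univ, q.2 * vorticity (u t) (v t) q.1 q.2) := by
        rw [← mul_assoc, inv_mul_cancel₀ het, one_mul]
    _ = Real.exp (-(t - s)) * ∫ q in Ioc 0 L ×ˢ univ, q.2 * vorticity (u s) (v s) q.1 q.2 := by
        rw [h, ← mul_assoc, ← Real.exp_neg, ← Real.exp_add, show -t + s = -(t - s) by ring]

end Summit.AnomalousDissipation.AnomalousDissipation.Theorems.StrainedLayerLaw.LogEnstrophyClock

end
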